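import Mathlib.Analysis.Calculus.ContDiff.Bounds
import Mathlib.Analysis.Calculus.FDeriv.Symmetric
import Mathlib.Analysis.Calculus.MeanValue
import Mathlib.Analysis.SpecialFunctions.ExpDeriv
import Mathlib.Analysis.InnerProductSpace.PiL2
import HarnessLib

/-!
# `C_b⁴` data for the Polchinski flow: derivatives up to order three of a `C⁴` function with bounded
# derivatives, their symmetry, and the closure of the class under `V₀ ↦ e^{−V₀}`, `(e^{−V₀}, F) ↦ e^{−V₀}F`
# (regularity bookkeeping for Bauerschmidt–Bodineau–Dagallier, Theorem 3)

Topic `Literature/Analysis/FunctionSpaces`; "proof architecture" file behind the named fact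
`Polchinski.BauerschmidtBodineau_multiscaleBakryEmery` ([BBD] Theorem 3, `MultiscaleBakryEmery.lean`).
The printed proof of Theorem 3 (p0016–p0017) differentiates `P_{0,t}F = W_t/Z_t` up to THIRD order in
space (Lemma 1 applies `L_t`, a second-order operator, to `(∇√P_{0,t}F)²_{Ċ_t}`) and once in time; in
the degenerate-covariance rendering of the tree (`PolchinskiHeatEquation.lean`, `PolchinskiGenerator.lean`)
this requires the integrands `e^{−V₀}` and `e^{−V₀}F` to be `C³` with bounded, uniformly continuous
derivatives.  This file packages that regularity from the user-facing hypothesis «`C⁴` with derivatives of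
orders `0,…,4` bounded by `B`»: the `HasFDerivAt` chains for `Ψ`, `∇Ψ`, `D²Ψ` and for the scalar partial
derivatives `∂_kΨ = DΨ(·)e_k` (with `∇∂_kΨ = D²Ψ(·)e_k`, `D²∂_kΨ = D³Ψ(·)e_k` by the symmetry of higher
derivatives), the sup bounds, the uniform continuity of `D²Ψ` and `D³Ψ(·)e_k`, the symmetry of the
second and third partial derivatives, and the closure of the hypothesis under `V₀ ↦ e^{−V₀}` and products
(`norm_iteratedFDeriv_comp_le`, `norm_iteratedFDeriv_mul_le`).

## Main results (sorry-free; no new definitions, no new named facts)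

* `Cb4.hasFDerivAt`, `Cb4.hasFDerivAt_fderiv`, `Cb4.hasFDerivAt_fderiv₂`, `Cb4.hasFDerivAt_fderiv₃`,
  bounds `Cb4.abs_le`, `Cb4.norm_fderiv_le` … `Cb4.norm_fderiv₄_le`, `Cb4.uniformContinuous_fderiv₂`, `Cb4.uniformContinuous_fderiv₃`;
* partials: `Cb4.hasFDerivAt_partial`, `Cb4.hasFDerivAt_fderiv_partial`, bounds and uniform continuity;
* symmetry: `Cb4.fderiv₂_symm`, `Cb4.fderiv₃_symm₁₂`, `Cb4.fderiv₃_symm₂₃`;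
* closure: `Cb4.exp_neg` (for `V₀`), `Cb4.mul`.

Nothing here concerns Yang–Mills.

## References

* [BauerschmidtBodineauDagallier2023] R. Bauerschmidt, T. Bodineau, B. Dagallier, Probab. Surveys 21
  (2024) 200–290, arXiv:2307.07619 — proof of Theorem 3 and Lemma 1, p0016–p0017 («for all bounded
  smooth functions `F`»; third spatial derivatives of `P_{0,t}F` in Lemma 1). READ (held text).
-/

noncomputable section

-- nested operator-norm instances `E →L[ℝ] E →L[ℝ] E →L[ℝ] ℝ`
set_option maxSynthPendingDepth 4

open Set Filter Topology

namespace Literature.Analysis.FunctionSpaces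

namespace Polchinski

variable {N : ℕ}

namespace Cb4

variable {Ψ : EuclideanSpace ℝ (Fin N) → ℝ} {B : ℝ}

/-! ### Norms of the successive Fréchet derivatives versus `iteratedFDeriv` -/

/-- `‖fderiv f x‖ = ‖iteratedFDeriv 1 f x‖`. [cite: BauerschmidtBodineauDagallier2023, Theorem 3 (proof)] -/
theorem norm_fderiv_eq_norm_iteratedFDeriv_one {F : Type*} [NormedAddCommGroup F] [NormedSpace ℝ F]
    (f : EuclideanSpace ℝ (Fin N) → F) (x : EuclideanSpace ℝ (Fin N)) :
    ‖fderiv ℝ f x‖ = ‖iteratedFDeriv ℝ 1 f x‖ := by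
  rw [← norm_iteratedFDeriv_fderiv (n := 0), norm_iteratedFDeriv_zero]

/-- `‖D(Df) x‖ = ‖iteratedFDeriv 2 f x‖`. [cite: BauerschmidtBodineauDagallier2023, Theorem 3 (proof)] -/
theorem norm_fderiv₂_eq_norm_iteratedFDeriv_two {F : Type*} [NormedAddCommGroup F] [NormedSpace ℝ F]
    (f : EuclideanSpace ℝ (Fin N) → F) (x : EuclideanSpace ℝ (Fin N)) :
    ‖fderiv ℝ (fderiv ℝ f) x‖ = ‖iteratedFDeriv ℝ 2 f x‖ := by
  rw [norm_fderiv_eq_norm_iteratedFDeriv_one, norm_iteratedFDeriv_fderiv]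

/-- `‖D(D(Df)) x‖ = ‖iteratedFDeriv 3 f x‖`. [cite: BauerschmidtBodineauDagallier2023, Theorem 3 (proof)] -/
theorem norm_fderiv₃_eq_norm_iteratedFDeriv_three {F : Type*} [NormedAddCommGroup F] [NormedSpace ℝ F]
    (f : EuclideanSpace ℝ (Fin N) → F) (x : EuclideanSpace ℝ (Fin N)) :
    ‖fderiv ℝ (fderiv ℝ (fderiv ℝ f)) x‖ = ‖iteratedFDeriv ℝ 3 f x‖ := by
  rw [norm_fderiv₂_eq_norm_iteratedFDeriv_two, norm_iteratedFDeriv_fderiv]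

/-- `‖D⁴f x‖ = ‖iteratedFDeriv 4 f x‖`. [cite: BauerschmidtBodineauDagallier2023, Theorem 3 (proof)] -/
theorem norm_fderiv₄_eq_norm_iteratedFDeriv_four {F : Type*} [NormedAddCommGroup F] [NormedSpace ℝ F]
    (f : EuclideanSpace ℝ (Fin N) → F) (x : EuclideanSpace ℝ (Fin N)) :
    ‖fderiv ℝ (fderiv ℝ (fderiv ℝ (fderiv ℝ f))) x‖ = ‖iteratedFDeriv ℝ 4 f x‖ := by
  rw [norm_fderiv₃_eq_norm_iteratedFDeriv_three, norm_iteratedFDeriv_fderiv]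

/-! ### The `HasFDerivAt` chain and the bounds -/

/-- `Ψ` is differentiable with derivative `fderiv Ψ`. [cite: BauerschmidtBodineauDagallier2023, Theorem 3 (proof)] -/
theorem hasFDerivAt (hΨ : ContDiff ℝ 4 Ψ) (x : EuclideanSpace ℝ (Fin N)) : HasFDerivAt Ψ (fderiv ℝ Ψ x) x :=
  ((hΨ.differentiable (by norm_num)) x).hasFDerivAt

/-- `∇Ψ` is differentiable with derivative `D²Ψ`. [cite: BauerschmidtBodineauDagallier2023, Theorem 3 (proof)] -/
theorem hasFDerivAt_fderiv (hΨ : ContDiff ℝ 4 Ψ) (x : EuclideanSpace ℝ (Fin N)) :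
    HasFDerivAt (fderiv ℝ Ψ) (fderiv ℝ (fderiv ℝ Ψ) x) x :=
  (((hΨ.fderiv_right (m := 3) (by norm_num)).differentiable (by norm_num)) x).hasFDerivAt

/-- `D²Ψ` is differentiable with derivative `D³Ψ`. [cite: BauerschmidtBodineauDagallier2023, Theorem 3 (proof)] -/
theorem hasFDerivAt_fderiv₂ (hΨ : ContDiff ℝ 4 Ψ) (x : EuclideanSpace ℝ (Fin N)) :
    HasFDerivAt (fderiv ℝ (fderiv ℝ Ψ)) (fderiv ℝ (fderiv ℝ (fderiv ℝ Ψ)) x) x :=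
  ((((hΨ.fderiv_right (m := 3) (by norm_num)).fderiv_right (m := 2) (by norm_num)).differentiable
    (by norm_num)) x).hasFDerivAt

/-- `D³Ψ` is differentiable with derivative `D⁴Ψ`. [cite: BauerschmidtBodineauDagallier2023, Theorem 3 (proof)] -/
theorem hasFDerivAt_fderiv₃ (hΨ : ContDiff ℝ 4 Ψ) (x : EuclideanSpace ℝ (Fin N)) :
    HasFDerivAt (fderiv ℝ (fderiv ℝ (fderiv ℝ Ψ))) (fderiv ℝ (fderiv ℝ (fderiv ℝ (fderiv ℝ Ψ))) x) x :=
  (((((hΨ.fderiv_right (m := 3) (by norm_num)).fderiv_right (m := 2) (by norm_num)).fderiv_right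
    (m := 1) (by norm_num)).differentiable (by norm_num)) x).hasFDerivAt

/-- `|Ψ x| ≤ B`. [cite: BauerschmidtBodineauDagallier2023, Theorem 3 (proof)] -/
theorem abs_le (hB : ∀ n ≤ 4, ∀ x, ‖iteratedFDeriv ℝ n Ψ x‖ ≤ B) (x : EuclideanSpace ℝ (Fin N)) :
    |Ψ x| ≤ B := by
  have h := hB 0 (by norm_num) x
  rwa [norm_iteratedFDeriv_zero, Real.norm_eq_abs] at h

/-- `‖∇Ψ x‖ ≤ B`. [cite: BauerschmidtBodineauDagallier2023, Theorem 3 (proof)] -/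
theorem norm_fderiv_le (hB : ∀ n ≤ 4, ∀ x, ‖iteratedFDeriv ℝ n Ψ x‖ ≤ B) (x : EuclideanSpace ℝ (Fin N)) :
    ‖fderiv ℝ Ψ x‖ ≤ B := by
  rw [norm_fderiv_eq_norm_iteratedFDeriv_one]; exact hB 1 (by norm_num) x

/-- `‖D²Ψ x‖ ≤ B`. [cite: BauerschmidtBodineauDagallier2023, Theorem 3 (proof)] -/
theorem norm_fderiv₂_le (hB : ∀ n ≤ 4, ∀ x, ‖iteratedFDeriv ℝ n Ψ x‖ ≤ B) (x : EuclideanSpace ℝ (Fin N)) :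
    ‖fderiv ℝ (fderiv ℝ Ψ) x‖ ≤ B := by
  rw [norm_fderiv₂_eq_norm_iteratedFDeriv_two]; exact hB 2 (by norm_num) x

/-- `‖D³Ψ x‖ ≤ B`. [cite: BauerschmidtBodineauDagallier2023, Theorem 3 (proof)] -/
theorem norm_fderiv₃_le (hB : ∀ n ≤ 4, ∀ x, ‖iteratedFDeriv ℝ n Ψ x‖ ≤ B) (x : EuclideanSpace ℝ (Fin N)) :
    ‖fderiv ℝ (fderiv ℝ (fderiv ℝ Ψ)) x‖ ≤ B := by
  rw [norm_fderiv₃_eq_norm_iteratedFDeriv_three]; exact hB 3 (by norm_num) x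

/-- `‖D⁴Ψ x‖ ≤ B`. [cite: BauerschmidtBodineauDagallier2023, Theorem 3 (proof)] -/
theorem norm_fderiv₄_le (hB : ∀ n ≤ 4, ∀ x, ‖iteratedFDeriv ℝ n Ψ x‖ ≤ B) (x : EuclideanSpace ℝ (Fin N)) :
    ‖fderiv ℝ (fderiv ℝ (fderiv ℝ (fderiv ℝ Ψ))) x‖ ≤ B := by
  rw [norm_fderiv₄_eq_norm_iteratedFDeriv_four]; exact hB 4 (by norm_num) x

/-! ### Uniform continuity from bounded derivatives -/

/-- Uniform continuity from a bounded Fréchet derivative (mean value inequality). [folklore] -/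
private theorem uc_of_fderiv_bound {Y : Type*} [NormedAddCommGroup Y] [NormedSpace ℝ Y]
    {H : EuclideanSpace ℝ (Fin N) → Y} {DH : EuclideanSpace ℝ (Fin N) → EuclideanSpace ℝ (Fin N) →L[ℝ] Y}
    (h1 : ∀ x, HasFDerivAt H (DH x) x) {K : ℝ} (hK : ∀ x, ‖DH x‖ ≤ K) : UniformContinuous H := by
  have hK0 : 0 ≤ K := le_trans (norm_nonneg _) (hK 0)
  have hlip : ∀ a b : EuclideanSpace ℝ (Fin N), ‖H a - H b‖ ≤ K * ‖a - b‖ := fun a b =>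
    Convex.norm_image_sub_le_of_norm_hasFDerivWithin_le (𝕜 := ℝ) (s := univ)
      (fun x _ => (h1 x).hasFDerivWithinAt) (fun x _ => hK x) convex_univ (mem_univ b) (mem_univ a)
  rw [Metric.uniformContinuous_iff]
  intro ε hε
  refine ⟨ε / (K + 1), by positivity, fun {a b} hab => ?_⟩
  rw [dist_eq_norm] at hab ⊢
  calc ‖H a - H b‖ ≤ K * ‖a - b‖ := hlip a b
    _ ≤ K * (ε / (K + 1)) := mul_le_mul_of_nonneg_left hab.le hK0
    _ < ε := by
      rw [mul_div_assoc', div_lt_iff₀ (by positivity)]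
      nlinarith

/-- `D²Ψ` is uniformly continuous (from `‖D³Ψ‖ ≤ B`). [cite: BauerschmidtBodineauDagallier2023, Theorem 3 (proof)] -/
theorem uniformContinuous_fderiv₂ (hΨ : ContDiff ℝ 4 Ψ) (hB : ∀ n ≤ 4, ∀ x, ‖iteratedFDeriv ℝ n Ψ x‖ ≤ B) :
    UniformContinuous (fderiv ℝ (fderiv ℝ Ψ)) :=
  uc_of_fderiv_bound (hasFDerivAt_fderiv₂ hΨ) (norm_fderiv₃_le hB)

/-- `D³Ψ` is uniformly continuous (from `‖D⁴Ψ‖ ≤ B`). [cite: BauerschmidtBodineauDagallier2023, Theorem 3 (proof)] -/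
theorem uniformContinuous_fderiv₃ (hΨ : ContDiff ℝ 4 Ψ) (hB : ∀ n ≤ 4, ∀ x, ‖iteratedFDeriv ℝ n Ψ x‖ ≤ B) :
    UniformContinuous (fderiv ℝ (fderiv ℝ (fderiv ℝ Ψ))) :=
  uc_of_fderiv_bound (hasFDerivAt_fderiv₃ hΨ) (norm_fderiv₄_le hB)

/-! ### Symmetry of the second and third derivatives -/

/-- Symmetry of `D²Ψ x`. [cite: BauerschmidtBodineauDagallier2023, Theorem 3 (proof)] -/
theorem fderiv₂_symm (hΨ : ContDiff ℝ 4 Ψ) (x v w : EuclideanSpace ℝ (Fin N)) :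
    fderiv ℝ (fderiv ℝ Ψ) x v w = fderiv ℝ (fderiv ℝ Ψ) x w v :=
  (hΨ.contDiffAt.isSymmSndFDerivAt (by rw [minSmoothness_of_isRCLikeNormedField]; norm_num)) v w

/-- Symmetry of `D³Ψ x` in its first two arguments (`D³Ψ = D²(∇Ψ)`).
[cite: BauerschmidtBodineauDagallier2023, Theorem 3 (proof)] -/
theorem fderiv₃_symm₁₂ (hΨ : ContDiff ℝ 4 Ψ) (x v w : EuclideanSpace ℝ (Fin N)) :
    fderiv ℝ (fderiv ℝ (fderiv ℝ Ψ)) x v w = fderiv ℝ (fderiv ℝ (fderiv ℝ Ψ)) x w v :=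
  ((hΨ.fderiv_right (m := 3) (by norm_num)).contDiffAt.isSymmSndFDerivAt
    (by rw [minSmoothness_of_isRCLikeNormedField]; norm_num)) v w

/-- Symmetry of `D³Ψ x v` as a bilinear form (`D³Ψ x v` is the derivative of the symmetric `D²Ψ`).
[cite: BauerschmidtBodineauDagallier2023, Theorem 3 (proof)] -/
theorem fderiv₃_symm₂₃ (hΨ : ContDiff ℝ 4 Ψ) (x v w u : EuclideanSpace ℝ (Fin N)) :
    fderiv ℝ (fderiv ℝ (fderiv ℝ Ψ)) x v w u = fderiv ℝ (fderiv ℝ (fderiv ℝ Ψ)) x v u w := by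
  -- the flip map on bilinear forms is a continuous linear map fixing `D²Ψ`
  set S : (EuclideanSpace ℝ (Fin N) →L[ℝ] EuclideanSpace ℝ (Fin N) →L[ℝ] ℝ) →L[ℝ]
      (EuclideanSpace ℝ (Fin N) →L[ℝ] EuclideanSpace ℝ (Fin N) →L[ℝ] ℝ) :=
    (ContinuousLinearMap.flipₗᵢ ℝ (EuclideanSpace ℝ (Fin N)) (EuclideanSpace ℝ (Fin N)) ℝ).toContinuousLinearEquiv.toContinuousLinearMap
    with hS
  have hSapp : ∀ (L : EuclideanSpace ℝ (Fin N) →L[ℝ] EuclideanSpace ℝ (Fin N) →L[ℝ] ℝ) (a b),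
      S L a b = L b a := fun L a b => rfl
  have hfix : (fun x => S (fderiv ℝ (fderiv ℝ Ψ) x)) = fderiv ℝ (fderiv ℝ Ψ) := by
    funext y
    ext a b
    rw [hSapp, fderiv₂_symm hΨ]
  have h1 : HasFDerivAt (fun x => S (fderiv ℝ (fderiv ℝ Ψ) x))
      (S.comp (fderiv ℝ (fderiv ℝ (fderiv ℝ Ψ)) x)) x :=
    S.hasFDerivAt.comp x (hasFDerivAt_fderiv₂ hΨ x)
  rw [hfix] at h1
  have h2 := (hasFDerivAt_fderiv₂ hΨ x).unique h1
  have h3 := congrArg (fun L => L v w u) h2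
  simp only [ContinuousLinearMap.comp_apply, hSapp] at h3
  exact h3

/-! ### Scalar partial derivatives `∂_kΨ = DΨ(·) e_k` -/

/-- The scalar partial `∂_kΨ(x) = DΨ(x)e_k` has gradient `D²Ψ(x)e_k` (symmetry of `D²Ψ`).
[cite: BauerschmidtBodineauDagallier2023, Theorem 3 (proof)] -/
theorem hasFDerivAt_partial (hΨ : ContDiff ℝ 4 Ψ) (v : EuclideanSpace ℝ (Fin N))
    (x : EuclideanSpace ℝ (Fin N)) :
    HasFDerivAt (fun x => fderiv ℝ Ψ x v) (fderiv ℝ (fderiv ℝ Ψ) x v) x := by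
  have h := (ContinuousLinearMap.apply ℝ ℝ v).hasFDerivAt.comp x (hasFDerivAt_fderiv hΨ x)
  have he : (ContinuousLinearMap.apply ℝ ℝ v).comp (fderiv ℝ (fderiv ℝ Ψ) x) =
      fderiv ℝ (fderiv ℝ Ψ) x v := by
    ext w
    simp only [ContinuousLinearMap.comp_apply, ContinuousLinearMap.apply_apply]
    exact fderiv₂_symm hΨ x w v
  rw [he] at h
  exact h

/-- The gradient `D²Ψ(·)e_k` of `∂_kΨ` has derivative `D³Ψ(x)e_k` (symmetry of `D³Ψ` in its first two
slots). [cite: BauerschmidtBodineauDagallier2023, Theorem 3 (proof)] -/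
theorem hasFDerivAt_fderiv_partial (hΨ : ContDiff ℝ 4 Ψ) (v : EuclideanSpace ℝ (Fin N))
    (x : EuclideanSpace ℝ (Fin N)) :
    HasFDerivAt (fun x => fderiv ℝ (fderiv ℝ Ψ) x v) (fderiv ℝ (fderiv ℝ (fderiv ℝ Ψ)) x v) x := by
  have h := (ContinuousLinearMap.apply ℝ (EuclideanSpace ℝ (Fin N) →L[ℝ] ℝ) v).hasFDerivAt.comp x
    (hasFDerivAt_fderiv₂ hΨ x)
  have he : (ContinuousLinearMap.apply ℝ (EuclideanSpace ℝ (Fin N) →L[ℝ] ℝ) v).comp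
      (fderiv ℝ (fderiv ℝ (fderiv ℝ Ψ)) x) = fderiv ℝ (fderiv ℝ (fderiv ℝ Ψ)) x v := by
    ext w u
    simp only [ContinuousLinearMap.comp_apply, ContinuousLinearMap.apply_apply]
    rw [fderiv₃_symm₁₂ hΨ x w v]
  rw [he] at h
  exact h

/-- `|∂_vΨ x| ≤ B‖v‖`. [cite: BauerschmidtBodineauDagallier2023, Theorem 3 (proof)] -/
theorem abs_partial_le (hB : ∀ n ≤ 4, ∀ x, ‖iteratedFDeriv ℝ n Ψ x‖ ≤ B)
    (v x : EuclideanSpace ℝ (Fin N)) : |fderiv ℝ Ψ x v| ≤ B * ‖v‖ := by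
  rw [← Real.norm_eq_abs]
  exact (ContinuousLinearMap.le_opNorm _ _).trans
    (mul_le_mul_of_nonneg_right (norm_fderiv_le hB x) (norm_nonneg _))

/-- `‖D²Ψ(x)v‖ ≤ B‖v‖`. [cite: BauerschmidtBodineauDagallier2023, Theorem 3 (proof)] -/
theorem norm_fderiv₂_apply_le (hB : ∀ n ≤ 4, ∀ x, ‖iteratedFDeriv ℝ n Ψ x‖ ≤ B)
    (v x : EuclideanSpace ℝ (Fin N)) : ‖fderiv ℝ (fderiv ℝ Ψ) x v‖ ≤ B * ‖v‖ :=
  (ContinuousLinearMap.le_opNorm _ _).trans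
    (mul_le_mul_of_nonneg_right (norm_fderiv₂_le hB x) (norm_nonneg _))

/-- `‖D³Ψ(x)v‖ ≤ B‖v‖`. [cite: BauerschmidtBodineauDagallier2023, Theorem 3 (proof)] -/
theorem norm_fderiv₃_apply_le (hB : ∀ n ≤ 4, ∀ x, ‖iteratedFDeriv ℝ n Ψ x‖ ≤ B)
    (v x : EuclideanSpace ℝ (Fin N)) : ‖fderiv ℝ (fderiv ℝ (fderiv ℝ Ψ)) x v‖ ≤ B * ‖v‖ :=
  (ContinuousLinearMap.le_opNorm _ _).trans
    (mul_le_mul_of_nonneg_right (norm_fderiv₃_le hB x) (norm_nonneg _))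

/-- `x ↦ D³Ψ(x)v` is uniformly continuous. [cite: BauerschmidtBodineauDagallier2023, Theorem 3 (proof)] -/
theorem uniformContinuous_fderiv₃_apply (hΨ : ContDiff ℝ 4 Ψ)
    (hB : ∀ n ≤ 4, ∀ x, ‖iteratedFDeriv ℝ n Ψ x‖ ≤ B) (v : EuclideanSpace ℝ (Fin N)) :
    UniformContinuous fun x => fderiv ℝ (fderiv ℝ (fderiv ℝ Ψ)) x v :=
  (ContinuousLinearMap.apply ℝ (EuclideanSpace ℝ (Fin N) →L[ℝ] EuclideanSpace ℝ (Fin N) →L[ℝ] ℝ)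
    v).uniformContinuous.comp (uniformContinuous_fderiv₃ hΨ hB)

/-- Evaluation of a basis vector: `‖e_k‖ = 1`. [cite: BauerschmidtBodineauDagallier2023, Theorem 3 (proof)] -/
theorem norm_single_one (k : Fin N) : ‖(EuclideanSpace.single k (1 : ℝ))‖ = 1 := by
  simp

/-! ### Closure under `V₀ ↦ e^{−V₀}` and under products -/

/-- Iterated derivatives of the real exponential have norm `e^y`. [folklore] -/
private theorem norm_iteratedFDeriv_exp (i : ℕ) (y : ℝ) :
    ‖iteratedFDeriv ℝ i Real.exp y‖ = Real.exp y := by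
  rw [norm_iteratedFDeriv_eq_norm_iteratedDeriv, iteratedDeriv_eq_iterate, Real.iter_deriv_exp,
    Real.norm_eq_abs, abs_of_pos (Real.exp_pos _)]

/-- **Closure under `V₀ ↦ e^{−V₀}`.**  If `V₀ ∈ C⁴` with `‖DⁿV₀‖ ≤ B` for `n ≤ 4`, then `e^{−V₀} ∈ C⁴` with
`‖Dⁿe^{−V₀}‖ ≤ 24·e^{B}·max(B,1)⁴` for `n ≤ 4` (Faà di Bruno bound `n!·C·Dⁿ`,
`norm_iteratedFDeriv_comp_le`). [cite: BauerschmidtBodineauDagallier2023, Theorem 3 (proof)] -/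
theorem exp_neg {V₀ : EuclideanSpace ℝ (Fin N) → ℝ} (hV : ContDiff ℝ 4 V₀) {B : ℝ}
    (hB : ∀ n ≤ 4, ∀ x, ‖iteratedFDeriv ℝ n V₀ x‖ ≤ B) :
    ContDiff ℝ 4 (fun x => Real.exp (-V₀ x)) ∧
      ∀ n ≤ 4, ∀ x, ‖iteratedFDeriv ℝ n (fun x => Real.exp (-V₀ x)) x‖ ≤
        24 * Real.exp B * max B 1 ^ 4 := by
  have hVn : ContDiff ℝ 4 (fun x => -V₀ x) := hV.neg
  have hcomp : (fun x => Real.exp (-V₀ x)) = Real.exp ∘ fun x => -V₀ x := rfl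
  refine ⟨Real.contDiff_exp.comp hVn, fun n hn x => ?_⟩
  have hB0 : 0 ≤ B := le_trans (norm_nonneg _) (hB 0 (by norm_num) x)
  set D : ℝ := max B 1 with hD
  have hD1 : 1 ≤ D := le_max_right _ _
  have hVx : |V₀ x| ≤ B := by
    have h := hB 0 (by norm_num) x
    rwa [norm_iteratedFDeriv_zero, Real.norm_eq_abs] at h
  have hC : ∀ i, i ≤ n → ‖iteratedFDeriv ℝ i Real.exp (-V₀ x)‖ ≤ Real.exp B := by
    intro i _
    rw [norm_iteratedFDeriv_exp]
    exact Real.exp_le_exp.2 (by linarith [neg_abs_le (V₀ x)])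
  have hDi : ∀ i, 1 ≤ i → i ≤ n → ‖iteratedFDeriv ℝ i (fun x => -V₀ x) x‖ ≤ D ^ i := by
    intro i hi hin
    have hneg : (fun x => -V₀ x) = -V₀ := rfl
    rw [hneg, iteratedFDeriv_neg_apply, norm_neg]
    calc ‖iteratedFDeriv ℝ i V₀ x‖ ≤ B := hB i (hin.trans hn) x
      _ ≤ D := le_max_left _ _
      _ ≤ D ^ i := le_self_pow₀ hD1 (by omega)
  have hmain := norm_iteratedFDeriv_comp_le (n := n) (N := 4) Real.contDiff_exp hVn
    (by exact_mod_cast hn) x hC hDi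
  rw [hcomp]
  refine hmain.trans ?_
  have hnf : (n.factorial : ℝ) ≤ 24 := by
    have : n.factorial ≤ 24 := by
      interval_cases n <;> decide
    exact_mod_cast this
  have hDn : D ^ n ≤ D ^ 4 := pow_le_pow_right₀ hD1 hn
  have hpos : 0 ≤ Real.exp B * D ^ n := by positivity
  calc (n.factorial : ℝ) * Real.exp B * D ^ n ≤ 24 * Real.exp B * D ^ n := by
        rw [mul_assoc, mul_assoc]; exact mul_le_mul_of_nonneg_right hnf hpos
    _ ≤ 24 * Real.exp B * D ^ 4 := by
        exact mul_le_mul_of_nonneg_left hDn (by positivity)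

/-- **Closure under products.**  If `f, g ∈ C⁴` with `‖Dⁿf‖ ≤ Bf`, `‖Dⁿg‖ ≤ Bg` (`n ≤ 4`), then `fg ∈ C⁴`
with `‖Dⁿ(fg)‖ ≤ 16·Bf·Bg` (Leibniz bound `norm_iteratedFDeriv_mul_le`, `Σ_i C(n,i) = 2ⁿ ≤ 16`).
[cite: BauerschmidtBodineauDagallier2023, Theorem 3 (proof)] -/
theorem mul {f g : EuclideanSpace ℝ (Fin N) → ℝ} (hf : ContDiff ℝ 4 f) (hg : ContDiff ℝ 4 g)
    {Bf Bg : ℝ} (hBf : ∀ n ≤ 4, ∀ x, ‖iteratedFDeriv ℝ n f x‖ ≤ Bf)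
    (hBg : ∀ n ≤ 4, ∀ x, ‖iteratedFDeriv ℝ n g x‖ ≤ Bg) :
    ContDiff ℝ 4 (fun x => f x * g x) ∧
      ∀ n ≤ 4, ∀ x, ‖iteratedFDeriv ℝ n (fun x => f x * g x) x‖ ≤ 16 * Bf * Bg := by
  refine ⟨hf.mul hg, fun n hn x => ?_⟩
  have hBf0 : 0 ≤ Bf := le_trans (norm_nonneg _) (hBf 0 (by norm_num) x)
  have hBg0 : 0 ≤ Bg := le_trans (norm_nonneg _) (hBg 0 (by norm_num) x)
  have h := norm_iteratedFDeriv_mul_le (n := n) (N := 4) hf hg x (by exact_mod_cast hn)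
  refine h.trans ?_
  have hterm : ∀ i ∈ Finset.range (n + 1),
      (n.choose i : ℝ) * ‖iteratedFDeriv ℝ i f x‖ * ‖iteratedFDeriv ℝ (n - i) g x‖ ≤
        (n.choose i : ℝ) * (Bf * Bg) := by
    intro i hi
    rw [Finset.mem_range] at hi
    rw [mul_assoc]
    refine mul_le_mul_of_nonneg_left ?_ (by positivity)
    exact mul_le_mul (hBf i (by omega) x) (hBg (n - i) (by omega) x) (norm_nonneg _) hBf0
  refine (Finset.sum_le_sum hterm).trans ?_
  rw [← Finset.sum_mul]
  have hsum : ∑ i ∈ Finset.range (n + 1), (n.choose i : ℝ) = 2 ^ n := by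
    have := Nat.sum_range_choose n
    exact_mod_cast this
  rw [hsum]
  have h2n : (2 : ℝ) ^ n ≤ 16 := by
    have : (2 : ℝ) ^ n ≤ 2 ^ 4 := pow_le_pow_right₀ (by norm_num) hn
    norm_num at this
    exact this
  calc (2 : ℝ) ^ n * (Bf * Bg) ≤ 16 * (Bf * Bg) :=
        mul_le_mul_of_nonneg_right h2n (mul_nonneg hBf0 hBg0)
    _ = 16 * Bf * Bg := by ring

end Cb4

end Polchinski

end Literature.Analysis.FunctionSpaces

end
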